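import Mathlib
import Summits.KontsevichZagierPeriods.Zeta5Search.CellStarWide
import Summits.KontsevichZagierPeriods.Zeta5Search.WedgeDictionaryKernelCellsPencil2
import Summits.KontsevichZagierPeriods.Zeta5Search.WedgeDictionaryKernelCellsPencil7
import Summits.KontsevichZagierPeriods.Zeta5Search.WedgeDictionaryKernelCellsPencil1
import HarnessLib

/-!
# The cellular PENCIL relations for the native slots `2`, `7`, `1` hold at EVERY convergent configuration
# (cell `pub-zeta5`, seat ct-1 g24)

HONEST FRAMING: systematic search; no irrationality claim unless certified.  Identities among Brown–Zudilin's absolutely convergent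
cellular integrals `I(a)` (arXiv:2210.03391, (1), (8)/(10), (16)); no integral is evaluated, nothing about `ζ(5)`; no `def`, no node.

gen-1 g21's NATIVE kernel cells `KernelCells.cellPencil_native_2/7/1` (family kernels on ONE contour, F1 + F2 — tree theorems) prove the
PENCIL three-term relation `−(c₂+1)(c₃+1)·I(a) + (c_i+1)(c₀+2−c_i)·I(a+DS) + fan_i(b(a+DS))·I(a+DS−s_i) = 0` (`c = b(a)`,
`DS = dsUp`: `b ↦ (b₀+2; b₁+1,…,b₇+1)`) for SYMBOLIC `a` under: convergence of the three members and a COMMON rational chamber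
point of the double Barnes integral (16).  The `@[conjecture]` node `CellPencil` (`cellPencil_holds`, ct-1 g17) packages them on the
HALF BOX only (`RegionHyp` at the three members).  This file removes the chamber condition exactly as ct-1 g23's `CellStarWide` did
for STAR: along `a ↦ a + n·𝟙` the three members converge and share the chamber point `(3n/4, 3n/4)` for all large `n`, the PENCIL
coefficients are explicit polynomials of degree `2` in `n`, and `CellStarWide.threeTerm_of_translates` (moments) brings the
relation back to `n = 0`.

* `translate_add_dsUp_slotDown`, `pencilBase_translate`, `pencilApex_translate` (the fan coefficients at `b(a + DS + n·𝟙)` are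
  `CellStarWide.fanCoeff_two/seven/one_translate` at `a + DS`);
* `chamber_pencil_translate` — the chamber point `(3n/4, 3n/4)` for `a+n𝟙`, `a+DS+n𝟙`, `a+DS−s_i+n𝟙` (`i = 2, 7, 1`);
* `pencil2/7/1_translate` — the native cells at the translates;
* **`cellPencil_wide_2`, `cellPencil_wide_7`, `cellPencil_wide_1`** — the PENCIL relation in slot `i ∈ {2, 7, 1}` WHENEVER
  `a`, `a + DS`, `a + DS − s_i` CONVERGE (no half box, no chamber).
Use (ct-1 g24): the cellular half of the PENCIL steps of the induction proving Brown–Zudilin's decomposition (4) on the whole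
convergence cone (a point with a negative dual slot is the BASE of a slot-2 pencil, a point with `d < 0` its APEX).
-/

noncomputable section

namespace Summit.KontsevichZagierPeriods.Zeta5Search.CellPencilWide

open MeasureTheory Set Filter Finset
open Literature.NumberTheory.Irrationality.BrownZudilin2022
open Summit.KontsevichZagierPeriods.Zeta5Search.WedgeDictionary
open Summit.KontsevichZagierPeriods.Zeta5Search.WedgeDictionary.KernelCells (cellPencil_native_2 cellPencil_native_7
  cellPencil_native_1)
open Summit.KontsevichZagierPeriods.Zeta5Search.WedgeDictionary.Kernel (ChamberQ)
open Summit.KontsevichZagierPeriods.Zeta5Search.AmpleGroupInvariance (bOfA_add_const shiftB)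
open Summit.KontsevichZagierPeriods.Zeta5Search.CellBridgeDischarge (converges_translate coord_abs_le chamberQ_vec
  translate_add_dsUp)
open Summit.KontsevichZagierPeriods.Zeta5Search.CellStarWide (threeTerm_of_translates chamber_translate fanCoeff_one_translate
  fanCoeff_two_translate fanCoeff_seven_translate)
open Summit.KontsevichZagierPeriods.Zeta5Search.CellularCubicalSubstitution (cellularIntegral_eq_cubicalIntegral_holds)
open Summit.KontsevichZagierPeriods.Zeta5Search.CubicalSubstitution (cubicalIntegral_eq_Jintegral_holds)
open Summit.KontsevichZagierPeriods.Zeta5Search.BarnesDouble (barnes_double_holds)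

/-! ## 1. The PENCIL cluster and its coefficients along `𝟙` -/

/-- `(a + n·𝟙) + DS − s_k = (a + DS − s_k) + n·𝟙`. [folklore] -/
theorem translate_add_dsUp_slotDown (a : Fin 8 → ℤ) (k : ℕ) (n : ℕ) :
    (fun i => a i + (n : ℤ)) + dsUp + slotDown k = fun i => (a + dsUp + slotDown k) i + (n : ℤ) := by
  funext i; simp only [Pi.add_apply]; ring

/-- The PENCIL base coefficient along `𝟙`: `pencilBase(b(a + n·𝟙)) = −(b₂ + 1 + n)(b₃ + 1 + n)`. [folklore] -/
theorem pencilBase_translate (a : Fin 8 → ℤ) (n : ℕ) :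
    pencilBase (bOfA (fun j => a j + (n : ℤ))) = -((bOfA a 2 + 1 + n) * (bOfA a 3 + 1 + n)) := by
  rw [bOfA_add_const]; simp [pencilBase, shiftB]; ring

/-- The PENCIL apex coefficient along `𝟙`: `pencilApex(b(a + n·𝟙), i) = (b_i + 1 + n)(b₀ + 2 − b_i + 2n)` (`1 ≤ i ≤ 7`). [folklore] -/
theorem pencilApex_translate (a : Fin 8 → ℤ) (n : ℕ) {i : ℕ} (hi : 1 ≤ i ∧ i ≤ 7) :
    pencilApex (bOfA (fun j => a j + (n : ℤ))) i = (bOfA a i + 1 + n) * (bOfA a 0 + 2 - bOfA a i + 2 * n) := by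
  have hi0 : i ≠ 0 := by omega
  unfold pencilApex
  rw [bOfA_add_const]
  simp only [shiftB, hi0, hi.2, ↓reduceIte]
  ring

/-! ## 2. The letters and the common chamber point of the translated PENCIL members -/

/-- The letters of `(a + n·𝟙) + DS`. [folklore] -/
theorem pOf_translate_dsUp (a : Fin 8 → ℤ) (n : ℕ) :
    pOf ((fun i => a i + (n : ℤ)) + dsUp) = ![a 4 + a 5 - a 7 + n, a 1 + a 2 - a 3 + a 5 - a 7 + n, a 5 + n,
      a 1 + a 2 + a 5 - a 7 + 1 + 2 * n, a 6 + n, a 2 + a 5 - a 7 + n, a 0 + a 1 - a 3 + a 5 - a 7 + n] := by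
  ext j; fin_cases j <;> simp only [pOf, Pi.add_apply] <;> simp [dsUp] <;> ring

/-- The `q`-letters of `(a + n·𝟙) + DS`. [folklore] -/
theorem qOf_translate_dsUp (a : Fin 8 → ℤ) (n : ℕ) :
    qOf ((fun i => a i + (n : ℤ)) + dsUp) = ![a 3 + 1 + n, a 4 + n, a 0 - a 2 + a 4 + n, a 0 + n, a 1 + 1 + n] := by
  ext j; fin_cases j <;> simp only [qOf, Pi.add_apply] <;> simp [dsUp] <;> ring

/-- The letters of `(a + n·𝟙) + DS − s₂`. [folklore] -/
theorem pOf_translate_dsUp_slotDown2 (a : Fin 8 → ℤ) (n : ℕ) :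
    pOf ((fun i => a i + (n : ℤ)) + dsUp + slotDown 2) = ![a 4 + a 5 - a 7 + n, a 1 + a 2 - a 3 + a 5 - a 7 + n, a 5 + n,
      a 1 + a 2 + a 5 - a 7 + 1 + 2 * n, a 6 + n, a 2 + a 5 - a 7 + 1 + n, a 0 + a 1 - a 3 + a 5 - a 7 + n] := by
  ext j; fin_cases j <;> simp only [pOf, Pi.add_apply] <;> simp [dsUp, slotDown] <;> ring

/-- The `q`-letters of `(a + n·𝟙) + DS − s₂`. [folklore] -/
theorem qOf_translate_dsUp_slotDown2 (a : Fin 8 → ℤ) (n : ℕ) :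
    qOf ((fun i => a i + (n : ℤ)) + dsUp + slotDown 2) = ![a 3 + 1 + n, a 4 + n, a 0 - a 2 + a 4 + n, a 0 + 1 + n, a 1 + n] := by
  ext j; fin_cases j <;> simp only [qOf, Pi.add_apply] <;> simp [dsUp, slotDown] <;> ring

/-- The letters of `(a + n·𝟙) + DS − s₇`. [folklore] -/
theorem pOf_translate_dsUp_slotDown7 (a : Fin 8 → ℤ) (n : ℕ) :
    pOf ((fun i => a i + (n : ℤ)) + dsUp + slotDown 7) = ![a 4 + a 5 - a 7 + n, a 1 + a 2 - a 3 + a 5 - a 7 + n, a 5 + n,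
      a 1 + a 2 + a 5 - a 7 + 1 + 2 * n, a 6 + 1 + n, a 2 + a 5 - a 7 + n, a 0 + a 1 - a 3 + a 5 - a 7 + n] := by
  ext j; fin_cases j <;> simp only [pOf, Pi.add_apply] <;> simp [dsUp, slotDown] <;> ring

/-- The `q`-letters of `(a + n·𝟙) + DS − s₇`. [folklore] -/
theorem qOf_translate_dsUp_slotDown7 (a : Fin 8 → ℤ) (n : ℕ) :
    qOf ((fun i => a i + (n : ℤ)) + dsUp + slotDown 7) = ![a 3 + 1 + n, a 4 + n, a 0 - a 2 + a 4 + n, a 0 + n, a 1 + 1 + n] := by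
  ext j; fin_cases j <;> simp only [qOf, Pi.add_apply] <;> simp [dsUp, slotDown] <;> ring

/-- The letters of `(a + n·𝟙) + DS − s₁`. [folklore] -/
theorem pOf_translate_dsUp_slotDown1 (a : Fin 8 → ℤ) (n : ℕ) :
    pOf ((fun i => a i + (n : ℤ)) + dsUp + slotDown 1) = ![a 4 + a 5 - a 7 + n, a 1 + a 2 - a 3 + a 5 - a 7 + n, a 5 + n,
      a 1 + a 2 + a 5 - a 7 + 1 + 2 * n, a 6 + n, a 2 + a 5 - a 7 + n, a 0 + a 1 - a 3 + a 5 - a 7 + 1 + n] := by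
  ext j; fin_cases j <;> simp only [pOf, Pi.add_apply] <;> simp [dsUp, slotDown] <;> ring

/-- The `q`-letters of `(a + n·𝟙) + DS − s₁`. [folklore] -/
theorem qOf_translate_dsUp_slotDown1 (a : Fin 8 → ℤ) (n : ℕ) :
    qOf ((fun i => a i + (n : ℤ)) + dsUp + slotDown 1) =
      ![a 3 + 1 + n, a 4 + n, a 0 - a 2 + a 4 + 1 + n, a 0 + 1 + n, a 1 + 1 + n] := by
  ext j; fin_cases j <;> simp only [qOf, Pi.add_apply] <;> simp [dsUp, slotDown] <;> ring

/-- The common chamber point `(3n/4, 3n/4)` of the translated PENCIL members, for `n ≥ 40·Σ|a_i| + 8`. [folklore] -/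
theorem chamber_pencil_translate (a : Fin 8 → ℤ) (n : ℕ) (hn : 40 * (∑ j : Fin 8, (a j).natAbs) + 8 ≤ n) :
    ChamberQ (pOf ((fun i => a i + (n : ℤ)) + dsUp)) (qOf ((fun i => a i + (n : ℤ)) + dsUp)) (3 * n / 4) (3 * n / 4) ∧
      ChamberQ (pOf ((fun i => a i + (n : ℤ)) + dsUp + slotDown 2)) (qOf ((fun i => a i + (n : ℤ)) + dsUp + slotDown 2))
        (3 * n / 4) (3 * n / 4) ∧
      ChamberQ (pOf ((fun i => a i + (n : ℤ)) + dsUp + slotDown 7)) (qOf ((fun i => a i + (n : ℤ)) + dsUp + slotDown 7))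
        (3 * n / 4) (3 * n / 4) ∧
      ChamberQ (pOf ((fun i => a i + (n : ℤ)) + dsUp + slotDown 1)) (qOf ((fun i => a i + (n : ℤ)) + dsUp + slotDown 1))
        (3 * n / 4) (3 * n / 4) := by
  obtain ⟨u0, l0⟩ := coord_abs_le a 0; obtain ⟨u1, l1⟩ := coord_abs_le a 1
  obtain ⟨u2, l2⟩ := coord_abs_le a 2; obtain ⟨u3, l3⟩ := coord_abs_le a 3
  obtain ⟨u4, l4⟩ := coord_abs_le a 4; obtain ⟨u5, l5⟩ := coord_abs_le a 5
  obtain ⟨u6, l6⟩ := coord_abs_le a 6; obtain ⟨u7, l7⟩ := coord_abs_le a 7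
  obtain ⟨K, hK⟩ : ∃ K : ℕ, K = ∑ j : Fin 8, (a j).natAbs := ⟨_, rfl⟩
  rw [← hK] at u0 l0 u1 l1 u2 l2 u3 l3 u4 l4 u5 l5 u6 l6 u7 l7 hn
  have hKn : (40 : ℚ) * K + 8 ≤ n := by exact_mod_cast hn
  have hK0 : (0 : ℚ) ≤ K := by positivity
  refine ⟨?_, ?_, ?_, ?_⟩
  · rw [pOf_translate_dsUp, qOf_translate_dsUp]
    refine chamberQ_vec ?_ ?_ ?_ ?_ ?_ ?_ ?_ ?_ ?_ <;> push_cast <;> linarith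
  · rw [pOf_translate_dsUp_slotDown2, qOf_translate_dsUp_slotDown2]
    refine chamberQ_vec ?_ ?_ ?_ ?_ ?_ ?_ ?_ ?_ ?_ <;> push_cast <;> linarith
  · rw [pOf_translate_dsUp_slotDown7, qOf_translate_dsUp_slotDown7]
    refine chamberQ_vec ?_ ?_ ?_ ?_ ?_ ?_ ?_ ?_ ?_ <;> push_cast <;> linarith
  · rw [pOf_translate_dsUp_slotDown1, qOf_translate_dsUp_slotDown1]
    refine chamberQ_vec ?_ ?_ ?_ ?_ ?_ ?_ ?_ ?_ ?_ <;> push_cast <;> linarith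

/-! ## 3. The native cells at the translates -/

/-- **The native PENCIL cell of slot `2` at the translates**: for `n ≥ 40·Σ|a_i| + 8` and the three translated members convergent,
`pencilBase·I(a+n𝟙) + pencilApex₂·I(a+DS+n𝟙) + fan₂(b(a+DS+n𝟙))·I(a+DS−s₂+n𝟙) = 0` with the coefficients at the translates. [folklore] -/
theorem pencil2_translate (a : Fin 8 → ℤ) (n : ℕ) (hn : 40 * (∑ j : Fin 8, (a j).natAbs) + 8 ≤ n)
    (hc0 : Converges (fun i => a i + (n : ℤ))) (hc1 : Converges (fun i => (a + dsUp) i + (n : ℤ)))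
    (hc2 : Converges (fun i => (a + dsUp + slotDown 2) i + (n : ℤ))) :
    ((pencilBase (bOfA (fun i => a i + (n : ℤ))) : ℚ) : ℝ) * cellularIntegral (fun i => a i + (n : ℤ)) +
      ((pencilApex (bOfA (fun i => a i + (n : ℤ))) 2 : ℚ) : ℝ) * cellularIntegral (fun i => (a + dsUp) i + (n : ℤ)) +
      ((fanCoeff (bOfA (fun i => (a + dsUp) i + (n : ℤ))) 2 : ℚ) : ℝ) *
        cellularIntegral (fun i => (a + dsUp + slotDown 2) i + (n : ℤ)) = 0 := by
  obtain ⟨h0, -, -, -⟩ := chamber_translate a n hn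
  obtain ⟨h1, h2, -, -⟩ := chamber_pencil_translate a n hn
  have hc1' : Converges ((fun i => a i + (n : ℤ)) + dsUp) := by rw [translate_add_dsUp]; exact hc1
  have hc2' : Converges ((fun i => a i + (n : ℤ)) + dsUp + slotDown 2) := by rw [translate_add_dsUp_slotDown]; exact hc2
  have key := cellPencil_native_2 cellularIntegral_eq_cubicalIntegral_holds cubicalIntegral_eq_Jintegral_holds
    barnes_double_holds (fun i => a i + (n : ℤ)) (3 * n / 4) (3 * n / 4) hc0 hc1' hc2' h0 h1 h2
  unfold ThreeTermRel at key
  rw [translate_add_dsUp_slotDown, translate_add_dsUp] at key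
  exact key

/-- **The native PENCIL cell of slot `7` at the translates.** [folklore] -/
theorem pencil7_translate (a : Fin 8 → ℤ) (n : ℕ) (hn : 40 * (∑ j : Fin 8, (a j).natAbs) + 8 ≤ n)
    (hc0 : Converges (fun i => a i + (n : ℤ))) (hc1 : Converges (fun i => (a + dsUp) i + (n : ℤ)))
    (hc2 : Converges (fun i => (a + dsUp + slotDown 7) i + (n : ℤ))) :
    ((pencilBase (bOfA (fun i => a i + (n : ℤ))) : ℚ) : ℝ) * cellularIntegral (fun i => a i + (n : ℤ)) +
      ((pencilApex (bOfA (fun i => a i + (n : ℤ))) 7 : ℚ) : ℝ) * cellularIntegral (fun i => (a + dsUp) i + (n : ℤ)) +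
      ((fanCoeff (bOfA (fun i => (a + dsUp) i + (n : ℤ))) 7 : ℚ) : ℝ) *
        cellularIntegral (fun i => (a + dsUp + slotDown 7) i + (n : ℤ)) = 0 := by
  obtain ⟨h0, -, -, -⟩ := chamber_translate a n hn
  obtain ⟨h1, -, h7, -⟩ := chamber_pencil_translate a n hn
  have hc1' : Converges ((fun i => a i + (n : ℤ)) + dsUp) := by rw [translate_add_dsUp]; exact hc1
  have hc2' : Converges ((fun i => a i + (n : ℤ)) + dsUp + slotDown 7) := by rw [translate_add_dsUp_slotDown]; exact hc2
  have key := cellPencil_native_7 cellularIntegral_eq_cubicalIntegral_holds cubicalIntegral_eq_Jintegral_holds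
    barnes_double_holds (fun i => a i + (n : ℤ)) (3 * n / 4) (3 * n / 4) hc0 hc1' hc2' h0 h1 h7
  unfold ThreeTermRel at key
  rw [translate_add_dsUp_slotDown, translate_add_dsUp] at key
  exact key

/-- **The native PENCIL cell of slot `1` at the translates.** [folklore] -/
theorem pencil1_translate (a : Fin 8 → ℤ) (n : ℕ) (hn : 40 * (∑ j : Fin 8, (a j).natAbs) + 8 ≤ n)
    (hc0 : Converges (fun i => a i + (n : ℤ))) (hc1 : Converges (fun i => (a + dsUp) i + (n : ℤ)))
    (hc2 : Converges (fun i => (a + dsUp + slotDown 1) i + (n : ℤ))) :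
    ((pencilBase (bOfA (fun i => a i + (n : ℤ))) : ℚ) : ℝ) * cellularIntegral (fun i => a i + (n : ℤ)) +
      ((pencilApex (bOfA (fun i => a i + (n : ℤ))) 1 : ℚ) : ℝ) * cellularIntegral (fun i => (a + dsUp) i + (n : ℤ)) +
      ((fanCoeff (bOfA (fun i => (a + dsUp) i + (n : ℤ))) 1 : ℚ) : ℝ) *
        cellularIntegral (fun i => (a + dsUp + slotDown 1) i + (n : ℤ)) = 0 := by
  obtain ⟨h0, -, -, -⟩ := chamber_translate a n hn
  obtain ⟨h1, -, -, h1'⟩ := chamber_pencil_translate a n hn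
  have hc1' : Converges ((fun i => a i + (n : ℤ)) + dsUp) := by rw [translate_add_dsUp]; exact hc1
  have hc2' : Converges ((fun i => a i + (n : ℤ)) + dsUp + slotDown 1) := by rw [translate_add_dsUp_slotDown]; exact hc2
  have key := cellPencil_native_1 cellularIntegral_eq_cubicalIntegral_holds cubicalIntegral_eq_Jintegral_holds
    barnes_double_holds (fun i => a i + (n : ℤ)) (3 * n / 4) (3 * n / 4) hc0 hc1' hc2' h0 h1 h1'
  unfold ThreeTermRel at key
  rw [translate_add_dsUp_slotDown, translate_add_dsUp] at key
  exact key

/-! ## 4. The PENCIL relations at every convergent configuration -/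

/-- `b(a + DS)` entries: `b₀ + 2` at `0`, `b_j + 1` at `1 ≤ j ≤ 7`. [folklore] -/
theorem bOfA_dsUp_apply (a : Fin 8 → ℤ) (n : ℕ) (hn : n ≤ 7) :
    bOfA (a + dsUp) n = if n = 0 then bOfA a 0 + 2 else bOfA a n + 1 := bOfA_add_dsUp a n hn

/-- **Cellular PENCIL in slot `2`, every convergent configuration**: if `a`, `a + DS`, `a + DS − s₂` converge, then
`−(c₂+1)(c₃+1)·I(a) + (c₂+1)(c₀+2−c₂)·I(a+DS) + fan₂(b(a+DS))·I(a+DS−s₂) = 0`, `c = b(a)`. [folklore] -/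
theorem cellPencil_wide_2 (a : Fin 8 → ℤ) (hc0 : Converges a) (hc1 : Converges (a + dsUp))
    (hc2 : Converges (a + dsUp + slotDown 2)) :
    ThreeTermRel (pencilBase (bOfA a)) (pencilApex (bOfA a) 2) (fanCoeff (bOfA (a + dsUp)) 2) a (a + dsUp)
      (a + dsUp + slotDown 2) := by
  have eP0 : bOfA (a + dsUp) 0 = bOfA a 0 + 2 := by rw [bOfA_dsUp_apply a 0 (by norm_num)]; simp
  have eP2 : bOfA (a + dsUp) 2 = bOfA a 2 + 1 := by rw [bOfA_dsUp_apply a 2 (by norm_num)]; simp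
  have eP7 : bOfA (a + dsUp) 7 = bOfA a 7 + 1 := by rw [bOfA_dsUp_apply a 7 (by norm_num)]; simp
  have key := threeTerm_of_translates ![a, a + dsUp, a + dsUp + slotDown 2]
    (by intro m; fin_cases m <;> assumption)
    ![-1, 2, 1]
    ![-(((bOfA a 2 : ℝ) + 1) + ((bOfA a 3 : ℝ) + 1)),
      2 * ((bOfA a 2 : ℝ) + 1) + ((bOfA a 0 : ℝ) + 2 - bOfA a 2),
      ((bOfA a 2 : ℝ) + 1) + ((bOfA a 0 : ℝ) + 1 - bOfA a 2 - bOfA a 7)]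
    ![-(((bOfA a 2 : ℝ) + 1) * ((bOfA a 3 : ℝ) + 1)),
      ((bOfA a 2 : ℝ) + 1) * ((bOfA a 0 : ℝ) + 2 - bOfA a 2),
      ((bOfA a 2 : ℝ) + 1) * ((bOfA a 0 : ℝ) + 1 - bOfA a 2 - bOfA a 7)]
    (N₀ := 40 * (∑ j : Fin 8, (a j).natAbs) + 8 + ((hList a).map Int.natAbs).sum +
      ((hList (a + dsUp)).map Int.natAbs).sum + ((hList (a + dsUp + slotDown 2)).map Int.natAbs).sum)
    (by
      intro n hn
      have h := pencil2_translate a n (by omega) (converges_translate (by omega)) (converges_translate (by omega))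
        (converges_translate (by omega))
      rw [pencilBase_translate, pencilApex_translate a n (by norm_num), fanCoeff_two_translate (a + dsUp) n, eP0, eP2, eP7] at h
      push_cast at h
      simp only [Fin.sum_univ_three, Matrix.cons_val_zero, Matrix.cons_val_one, Matrix.head_cons, Matrix.cons_val_two,
        Matrix.tail_cons]
      linear_combination h)
  unfold ThreeTermRel
  simp only [Fin.sum_univ_three, Matrix.cons_val_zero, Matrix.cons_val_one, Matrix.head_cons, Matrix.cons_val_two,
    Matrix.tail_cons] at key
  simp only [pencilBase, pencilApex, fanCoeff, chiOf, nonEdgePartners, List.map, List.prod_cons, List.prod_nil, or_false,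
    ↓reduceIte, Nat.reduceEqDiff, eP0, eP2, eP7]
  push_cast
  linear_combination key

/-- **Cellular PENCIL in slot `7`, every convergent configuration.** [folklore] -/
theorem cellPencil_wide_7 (a : Fin 8 → ℤ) (hc0 : Converges a) (hc1 : Converges (a + dsUp))
    (hc2 : Converges (a + dsUp + slotDown 7)) :
    ThreeTermRel (pencilBase (bOfA a)) (pencilApex (bOfA a) 7) (fanCoeff (bOfA (a + dsUp)) 7) a (a + dsUp)
      (a + dsUp + slotDown 7) := by
  have eP0 : bOfA (a + dsUp) 0 = bOfA a 0 + 2 := by rw [bOfA_dsUp_apply a 0 (by norm_num)]; simp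
  have eP1 : bOfA (a + dsUp) 1 = bOfA a 1 + 1 := by rw [bOfA_dsUp_apply a 1 (by norm_num)]; simp
  have eP2 : bOfA (a + dsUp) 2 = bOfA a 2 + 1 := by rw [bOfA_dsUp_apply a 2 (by norm_num)]; simp
  have eP7 : bOfA (a + dsUp) 7 = bOfA a 7 + 1 := by rw [bOfA_dsUp_apply a 7 (by norm_num)]; simp
  have key := threeTerm_of_translates ![a, a + dsUp, a + dsUp + slotDown 7]
    (by intro m; fin_cases m <;> assumption)
    ![-1, 2, 1]
    ![-(((bOfA a 2 : ℝ) + 1) + ((bOfA a 3 : ℝ) + 1)),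
      2 * ((bOfA a 7 : ℝ) + 1) + ((bOfA a 0 : ℝ) + 2 - bOfA a 7),
      ((bOfA a 0 : ℝ) + 1 - bOfA a 7 - bOfA a 1) + ((bOfA a 0 : ℝ) + 1 - bOfA a 7 - bOfA a 2)]
    ![-(((bOfA a 2 : ℝ) + 1) * ((bOfA a 3 : ℝ) + 1)),
      ((bOfA a 7 : ℝ) + 1) * ((bOfA a 0 : ℝ) + 2 - bOfA a 7),
      ((bOfA a 0 : ℝ) + 1 - bOfA a 7 - bOfA a 1) * ((bOfA a 0 : ℝ) + 1 - bOfA a 7 - bOfA a 2)]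
    (N₀ := 40 * (∑ j : Fin 8, (a j).natAbs) + 8 + ((hList a).map Int.natAbs).sum +
      ((hList (a + dsUp)).map Int.natAbs).sum + ((hList (a + dsUp + slotDown 7)).map Int.natAbs).sum)
    (by
      intro n hn
      have h := pencil7_translate a n (by omega) (converges_translate (by omega)) (converges_translate (by omega))
        (converges_translate (by omega))
      rw [pencilBase_translate, pencilApex_translate a n (by norm_num), fanCoeff_seven_translate (a + dsUp) n, eP0, eP1, eP2, eP7] at h
      push_cast at h
      simp only [Fin.sum_univ_three, Matrix.cons_val_zero, Matrix.cons_val_one, Matrix.head_cons, Matrix.cons_val_two,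
        Matrix.tail_cons]
      linear_combination h)
  unfold ThreeTermRel
  simp only [Fin.sum_univ_three, Matrix.cons_val_zero, Matrix.cons_val_one, Matrix.head_cons, Matrix.cons_val_two,
    Matrix.tail_cons] at key
  simp only [pencilBase, pencilApex, fanCoeff, chiOf, nonEdgePartners, List.map, List.prod_cons, List.prod_nil,
    or_self, ↓reduceIte, Nat.reduceEqDiff, eP0, eP1, eP2, eP7]
  push_cast
  linear_combination key

/-- **Cellular PENCIL in slot `1`, every convergent configuration.** [folklore] -/
theorem cellPencil_wide_1 (a : Fin 8 → ℤ) (hc0 : Converges a) (hc1 : Converges (a + dsUp))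
    (hc2 : Converges (a + dsUp + slotDown 1)) :
    ThreeTermRel (pencilBase (bOfA a)) (pencilApex (bOfA a) 1) (fanCoeff (bOfA (a + dsUp)) 1) a (a + dsUp)
      (a + dsUp + slotDown 1) := by
  have eP0 : bOfA (a + dsUp) 0 = bOfA a 0 + 2 := by rw [bOfA_dsUp_apply a 0 (by norm_num)]; simp
  have eP1 : bOfA (a + dsUp) 1 = bOfA a 1 + 1 := by rw [bOfA_dsUp_apply a 1 (by norm_num)]; simp
  have eP6 : bOfA (a + dsUp) 6 = bOfA a 6 + 1 := by rw [bOfA_dsUp_apply a 6 (by norm_num)]; simp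
  have eP7 : bOfA (a + dsUp) 7 = bOfA a 7 + 1 := by rw [bOfA_dsUp_apply a 7 (by norm_num)]; simp
  have key := threeTerm_of_translates ![a, a + dsUp, a + dsUp + slotDown 1]
    (by intro m; fin_cases m <;> assumption)
    ![-1, 2, 1]
    ![-(((bOfA a 2 : ℝ) + 1) + ((bOfA a 3 : ℝ) + 1)),
      2 * ((bOfA a 1 : ℝ) + 1) + ((bOfA a 0 : ℝ) + 2 - bOfA a 1),
      ((bOfA a 0 : ℝ) + 1 - bOfA a 1 - bOfA a 6) + ((bOfA a 0 : ℝ) + 1 - bOfA a 1 - bOfA a 7)]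
    ![-(((bOfA a 2 : ℝ) + 1) * ((bOfA a 3 : ℝ) + 1)),
      ((bOfA a 1 : ℝ) + 1) * ((bOfA a 0 : ℝ) + 2 - bOfA a 1),
      ((bOfA a 0 : ℝ) + 1 - bOfA a 1 - bOfA a 6) * ((bOfA a 0 : ℝ) + 1 - bOfA a 1 - bOfA a 7)]
    (N₀ := 40 * (∑ j : Fin 8, (a j).natAbs) + 8 + ((hList a).map Int.natAbs).sum +
      ((hList (a + dsUp)).map Int.natAbs).sum + ((hList (a + dsUp + slotDown 1)).map Int.natAbs).sum)
    (by
      intro n hn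
      have h := pencil1_translate a n (by omega) (converges_translate (by omega)) (converges_translate (by omega))
        (converges_translate (by omega))
      rw [pencilBase_translate, pencilApex_translate a n (by norm_num), fanCoeff_one_translate (a + dsUp) n, eP0, eP1, eP6, eP7] at h
      push_cast at h
      simp only [Fin.sum_univ_three, Matrix.cons_val_zero, Matrix.cons_val_one, Matrix.head_cons, Matrix.cons_val_two,
        Matrix.tail_cons]
      linear_combination h)
  unfold ThreeTermRel
  simp only [Fin.sum_univ_three, Matrix.cons_val_zero, Matrix.cons_val_one, Matrix.head_cons, Matrix.cons_val_two,
    Matrix.tail_cons] at key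
  simp only [pencilBase, pencilApex, fanCoeff, chiOf, nonEdgePartners, List.map, List.prod_cons, List.prod_nil,
    or_self, ↓reduceIte, Nat.reduceEqDiff, eP0, eP1, eP6, eP7]
  push_cast
  linear_combination key

end Summit.KontsevichZagierPeriods.Zeta5Search.CellPencilWide

end
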